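import Summits.QuantumFields.QCD.Theorems.PauliWegnerSeaFMClosureUnquenchedClosureC1Aux1
import Summits.QuantumFields.QCD.Theorems.PauliWegnerSeaFMClosureUnquenchedClosureC1Aux7

/-!
# Crux `FMClosureUnquenched` (stmt-QuantumFields-11512), line `von-mises-circles`: stub `stub_closure`

**Theorem (`stub_closure`).** For every regularisation and positive renormalised masses: the two-star bounds,
far stability, the collar resolvent bounds, the unit-shell lower bound, the hopping decay and the crux's
one-scale `Input` imply the outward decay package `OutwardDecayWith` (decay of the phase-quenched fractional
moment `cruxMoment` at rate `δ a_k` beyond the input radius, k-uniform constants).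

Proof (the finite-volume fractional-moment criterion of Aizenman–Schenker–Friedrich–Hundertmark transplanted
to phase-quenched lattice QCD; helpers `…ClosureC1Aux1–7`): choose ONE `q` (polynomial losses vs. the gain
`Θ^{-θqσ}`, `Θ = min 2 (1+β₀)`); at step `k` and flavour `f`, in the hopping window use `HoppingDecay`;
otherwise the probe mass lies in `[-9, 1]`, the corner `ℓ₀ = 1, |β_k| ≤ β₀` contradicts the unit-shell lower
bound, so `Θ_k = ℓ₀(1+|β_k|) ≥ Θ`, and the one-volume bootstrap (`c1_volume_bootstrap`: forward step,
exit moment, two-cut subharmonicity with far stability, iteration) feeds the rate arithmetic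
`c1_closure_rate` (uniformity in `k` from `ℓ₀ a_k ≤ K₀(1+|log a_k|)`).

References: Aizenman–Schenker–Friedrich–Hundertmark, CMP 224 (2001) 219, §2, Thm 2 [AizenmanEtAl2001];
Montvay–Münster, *Quantum Fields on a Lattice* (CUP 1994) §5.1 [MontvayMunster1994].
-/

noncomputable section

open scoped BigOperators
open MeasureTheory Filter
open Literature.MathematicalPhysics.QuantumFieldTheory Literature.MathematicalPhysics.QuantumLattice
  Literature.Probability.LatticeModels
open Summit.QuantumFields.QCD.Theorems.VonMisesCircles

namespace Summit.QuantumFields.QCD.Theorems.VonMisesCirclesC1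

/-- **The bootstrap at one volume** (rate-free bound + collar bound, constants depending on the package
constants only). [cite: AizenmanEtAl2001, §2 and proof of Thm 2] -/
theorem c1_volume_bootstrap {Nf : ℕ} {s₀ C p s₀' Cf pf θ : ℝ} (hC : 0 < C) (hCf : 0 < Cf) (hθ0 : 0 < θ)
    (hθ1 : θ ≤ 1)
    (hT : ∀ s : ℝ, 0 < s → s ≤ s₀ →
      ∀ (β : ℝ) (mq : Fin Nf → ℝ) (f : Fin Nf), -9 ≤ mq f → mq f ≤ 1 → ∀ (S : ℕ),
        (0 < ∫ U : GaugeConfig 4 (2 * S + 1) (Matrix.specialUnitaryGroup (Fin 3) ℂ),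
            ‖(diracMatrix U mq).det‖ ∂(wilsonMeasure (fundamentalRep (Fin 3)) β)) ∧
        (∀ (s₁ s₂ s₃ : ℝ), 0 ≤ s₁ → s₁ ≤ s₀ → 0 ≤ s₂ → s₂ ≤ s₀ → 0 ≤ s₃ → s₃ ≤ s₀ →
          ∀ (A₁ A₂ A₃ : Finset (TorusSite 4 (2 * S + 1))),
            AdmissibleSide S A₁ → AdmissibleSide S A₂ → AdmissibleSide S A₃ →
          ∀ (a₁ b₁ a₂ b₂ a₃ b₃ : TorusSite 4 (2 * S + 1)),
          Integrable (fun U : GaugeConfig 4 (2 * S + 1) (Matrix.specialUnitaryGroup (Fin 3) ℂ) =>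
            ‖(diracMatrix U mq).det‖ *
              (blockNorm (gside A₁ (wilsonD U (mq f))) a₁ b₁ ^ s₁ *
                blockNorm (gside A₂ (wilsonD U (mq f))) a₂ b₂ ^ s₂ *
                blockNorm (gside A₃ (wilsonD U (mq f))) a₃ b₃ ^ s₃))
            (wilsonMeasure (fundamentalRep (Fin 3)) β)) ∧
        (∀ (A : Finset (TorusSite 4 (2 * S + 1))), AdmissibleSide S A →
          ∀ᵐ U ∂(wilsonMeasure (fundamentalRep (Fin 3)) β), (sideMatrix A (wilsonD U (mq f))).det ≠ 0) ∧
        (∀ x y : TorusSite 4 (2 * S + 1),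
          pqE Nf S β mq (fun U => blockNorm (wilsonD U (mq f))⁻¹ x y ^ s) ≤ C * (1 + |β|) ^ p) ∧
        (∀ (x : TorusSite 4 (2 * S + 1)) (r : ℕ), 1 ≤ r → r + 1 ≤ S →
          ∀ (A : Finset (TorusSite 4 (2 * S + 1))),
            (A = ebox S x r ∨ A = (ebox S x r)ᶜ ∨ A = (ball S x r)ᶜ) →
          ∀ a b c d : TorusSite 4 (2 * S + 1), a ∈ A → b ∈ A →
            pqE Nf S β mq (fun U =>
                blockNorm (gside A (wilsonD U (mq f))) a b ^ s * blockNorm (wilsonD U (mq f))⁻¹ c d ^ s) ≤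
              C * (1 + |β|) ^ p * (1 + (r : ℝ)) ^ p *
                pqE Nf S β mq (fun U => blockNorm (wilsonD U (mq f))⁻¹ c d ^ s)) ∧
        (∀ (x : TorusSite 4 (2 * S + 1)) (ℓ : ℕ), 1 ≤ ℓ → 3 * ℓ + 4 ≤ S →
          ∀ u u' v v' y : TorusSite 4 (2 * S + 1),
            u' ∈ ebox S x (3 * ℓ + 2) → u' ∉ ebox S x ℓ → v ∈ ebox S x (3 * ℓ + 2) → v ∉ ebox S x ℓ →
            v' ∉ ebox S x (3 * ℓ + 2) → y ∉ ebox S x (3 * ℓ + 2) →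
              pqE Nf S β mq (fun U =>
                  blockNorm (gside (ebox S x ℓ) (wilsonD U (mq f))) x u ^ s *
                    blockNorm (wilsonD U (mq f))⁻¹ u' v ^ s *
                    blockNorm (gside (ebox S x (3 * ℓ + 2))ᶜ (wilsonD U (mq f))) v' y ^ s) ≤
                C * (1 + |β|) ^ p * (1 + (ℓ : ℝ)) ^ p *
                  pqE Nf S β mq (fun U =>
                    blockNorm (gside (ebox S x ℓ) (wilsonD U (mq f))) x u ^ s *
                      blockNorm (gside (ebox S x (3 * ℓ + 2))ᶜ (wilsonD U (mq f))) v' y ^ s)))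
    (hF : ∀ s : ℝ, 0 < s → s ≤ s₀' →
      ∀ (β : ℝ) (mq : Fin Nf → ℝ) (f : Fin Nf), -9 ≤ mq f → mq f ≤ 1 →
      ∀ (S : ℕ) (x : TorusSite 4 (2 * S + 1)) (ℓ : ℕ), 1 ≤ ℓ → 3 * ℓ + 4 ≤ S →
      ∀ u v' y : TorusSite 4 (2 * S + 1),
        u ∈ ebox S x ℓ → v' ∉ ebox S x (3 * ℓ + 2) → y ∉ ebox S x (3 * ℓ + 2) →
        pqE Nf S β mq (fun U =>
            blockNorm (gside (ebox S x ℓ) (wilsonD U (mq f))) x u ^ s *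
              blockNorm (gside (ebox S x (3 * ℓ + 2))ᶜ (wilsonD U (mq f))) v' y ^ s) ≤
          Cf * (1 + |β|) ^ pf * (1 + (ℓ : ℝ)) ^ pf *
            (pqE Nf S β mq (fun U => blockNorm (gside (ebox S x ℓ) (wilsonD U (mq f))) x u ^ s) ^ θ +
              pqE Nf S β mq (fun U => blockNorm (gside (ebox S x ℓ) (wilsonD U (mq f))) x u ^ s)) *
            pqE Nf S β mq (fun U =>
              blockNorm (gside (ebox S x (3 * ℓ + 2))ᶜ (wilsonD U (mq f))) v' y ^ s))
    (hCR : CollarResolventBounds) :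
    ∃ C₁ c₁ Cb cb CM cM : ℝ, 1 ≤ C₁ ∧ 0 ≤ c₁ ∧ 1 ≤ Cb ∧ 0 ≤ cb ∧ 0 ≤ CM ∧ 0 ≤ cM ∧
      ∀ (β t : ℝ) (mq : Fin Nf → ℝ) (f : Fin Nf) (S ℓ₀ : ℕ) (κ : ℝ),
        0 < t → t ≤ 1 → t ≤ s₀ → t ≤ s₀' → -9 ≤ mq f → mq f ≤ 1 → 1 ≤ ℓ₀ → ℓ₀ ≤ S → 0 ≤ κ →
        (∀ w : Site 4, w ∈ box 4 S → ‖w‖ = (ℓ₀ : ℝ) →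
          pqE Nf S β mq (fun U => blockNorm (wilsonD U (mq f))⁻¹ 0 (Torus.proj (2 * S + 1) w) ^ t) ≤
            ((ℓ₀ : ℝ) * (1 + |β|)) ^ (-κ)) →
        (∀ v : Site 4, v ∈ box 4 S → ℓ₀ ≤ Site.supNorm v →
          pqE Nf S β mq (fun U => blockNorm (wilsonD U (mq f))⁻¹ 0 (Torus.proj (2 * S + 1) v) ^ t) ≤
            C₁ * ((ℓ₀ : ℝ) * (1 + |β|)) ^ (c₁ - κ)) ∧
        (3 * ℓ₀ + 4 ≤ S → Cb * ((ℓ₀ : ℝ) * (1 + |β|)) ^ (cb - θ * κ) ≤ 1 →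
          ∀ v : Site 4, v ∈ box 4 S →
            ∃ b M : ℝ, 0 ≤ b ∧ b ≤ Cb * ((ℓ₀ : ℝ) * (1 + |β|)) ^ (cb - θ * κ) ∧ 0 ≤ M ∧
              M ≤ CM * ((ℓ₀ : ℝ) * (1 + |β|)) ^ cM ∧
              pqE Nf S β mq (fun U => blockNorm (wilsonD U (mq f))⁻¹ 0 (Torus.proj (2 * S + 1) v) ^ t) ≤
                M * b ^ (Site.supNorm v / (3 * ℓ₀ + 4))) := by
  obtain ⟨cT, hcT, hRall⟩ := c1_collar_defs hCR
  -- the master constants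
  set 𝕂 : ℝ := max (max 2 (cT ^ 2)) (max (max (C * 6 ^ (max p 0)) (Cf * 6 ^ (max pf 0))) ((14 : ℝ) ^ 4)) with h𝕂
  set 𝕔 : ℝ := 2 * max p 0 + 2 * max pf 0 + 4 with h𝕔
  have hK2 : 2 ≤ 𝕂 := c1_two_le_K h𝕂
  have hK1 : 1 ≤ 𝕂 := by linarith
  have hc0 : 0 ≤ 𝕔 := c1_c_nonneg (p := p) (pf := pf) h𝕔
  refine ⟨𝕂 ^ 4, ((4 : ℕ) : ℝ) * 𝕔, 𝕂 ^ 23, ((23 : ℕ) : ℝ) * 𝕔, 𝕂 ^ 1, ((1 : ℕ) : ℝ) * 𝕔,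
    one_le_pow₀ hK1, by positivity, one_le_pow₀ hK1, by positivity, by positivity, by positivity, ?_⟩
  intro β t mq f S ℓ₀ κ ht0 ht1 hts hts' hm9 hm1 hℓ1 hℓS hκ hshell
  -- the clauses at this volume
  obtain ⟨-, hT0, hTinv, hT5, hTdec, hT1⟩ := hT t ht0 hts β mq f hm9 hm1 S
  have hFar := hF t ht0 hts' β mq f hm9 hm1 S
  have hR : ∀ (U : GaugeConfig 4 (2 * S + 1) (Matrix.specialUnitaryGroup (Fin 3) ℂ))
      (x : TorusSite 4 (2 * S + 1)), _ := fun U x => hRall S U (mq f) x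
  have hΘ0 : 0 < (ℓ₀ : ℝ) * (1 + |β|) := by
    have : (1 : ℝ) ≤ ℓ₀ := by exact_mod_cast hℓ1
    have := abs_nonneg β
    positivity
  refine ⟨fun v hv hn => ?_, fun hfit hsmall v hv => ?_⟩
  · have h := c1_ratefree ht0 ht1 hts hcT hC h𝕂 h𝕔 hT0 hTinv hTdec hR hℓ1 hℓS rfl hshell v hv hn
    rw [sub_eq_add_neg, Real.rpow_add hΘ0, ← mul_assoc]
    exact h
  · have hsmall' : 𝕂 ^ 23 * ((ℓ₀ : ℝ) * (1 + |β|)) ^ (((23 : ℕ) : ℝ) * 𝕔) *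
        ((ℓ₀ : ℝ) * (1 + |β|)) ^ (-(θ * κ)) ≤ 1 := by
      rw [mul_assoc, ← Real.rpow_add hΘ0, ← sub_eq_add_neg]
      exact hsmall
    obtain ⟨b, M, hb0, hb, hM0, hM, hE⟩ := c1_collar_bound ht0 ht1 hts hcT hC hCf hθ0 hθ1 h𝕂 h𝕔 hT0 hTinv hT5
      hTdec hT1 hFar hR hℓ1 hℓS rfl hκ hshell hfit hsmall' v hv
    refine ⟨b, M, hb0, ?_, hM0, hM, hE⟩
    rw [sub_eq_add_neg, Real.rpow_add hΘ0, ← mul_assoc]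
    exact hb

/-- **`stub_closure`** of crux stmt-QuantumFields-11512 (line `von-mises-circles`): the outward bootstrap.
[cite: AizenmanEtAl2001, §2 and Thm 2] -/
theorem stub_closure :
    ∀ (Nf : ℕ) (reg : QCDRegularisation Nf) (m : Fin Nf → ℝ), (∀ f, 0 < m f) →
      TwoStarBounds Nf → FarStability Nf → CollarResolventBounds → UnitShellLowerBound Nf →
        HoppingDecay Nf → Input Nf reg m →
          ∃ (s δ C K₀ : ℝ) (ℓ₀ : ℕ → Fin Nf → ℕ), OutwardDecayWith Nf reg m s δ C K₀ ℓ₀ := by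
  intro Nf reg m _hm hTS hFS hCR hUS hHD hIn
  classical
  obtain ⟨s₀, C, p, hs₀, _hs₀1, hC, hT⟩ := hTS
  obtain ⟨s₀', Cf, pf, θ, hs₀', _hs₀'1, hCf, hθ0, hθ1, hF⟩ := hFS
  obtain ⟨β₀, hβ₀, S₀, hU⟩ := hUS
  obtain ⟨CH, μ, hCH, hμ, hH⟩ := hHD
  obtain ⟨C₁, c₁, Cb, cb, CM, cM, hC₁, hc₁, hCb, hcb, hCM, hcM, hboot⟩ :=
    c1_volume_bootstrap hC hCf hθ0 hθ1 hT hF hCR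
  -- exponent floor `σ` and size threshold `Θ`
  obtain ⟨σ, hσ0, hσs₀, hσs₀', hσ12⟩ : ∃ σ : ℝ, 0 < σ ∧ σ ≤ s₀ ∧ σ ≤ s₀' ∧ σ ≤ 1 / 2 :=
    ⟨min (min s₀ s₀') (1 / 2), lt_min (lt_min hs₀ hs₀') (by norm_num),
      (min_le_left _ _).trans (min_le_left _ _), (min_le_left _ _).trans (min_le_right _ _), min_le_right _ _⟩
  obtain ⟨Θ, hΘ1, hΘ2, hΘβ⟩ : ∃ Θ : ℝ, 1 < Θ ∧ Θ ≤ 2 ∧ Θ ≤ 1 + β₀ :=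
    ⟨min 2 (1 + β₀), lt_min (by norm_num) (by linarith), min_le_left _ _, min_le_right _ _⟩
  have hΘ0 : 0 < Θ := by linarith
  have hlogΘ : 0 < Real.log Θ := Real.log_pos hΘ1
  -- choice of `q`
  set A : ℝ := max (2 * Cb) (CM * Cb) with hA
  have hA2 : 2 * Cb ≤ A := le_max_left _ _
  have hAM : CM * Cb ≤ A := le_max_right _ _
  have hA1 : 1 ≤ A := by linarith
  have hA0 : 0 < A := by linarith
  have hLA : 0 ≤ Real.log A / Real.log Θ := div_nonneg (Real.log_nonneg hA1) hlogΘ.le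
  obtain ⟨q, hq⟩ := c1_exists_nat_mul_ge (θ * σ) (c₁ + cb + cM + 1 + Real.log A / Real.log Θ) (by positivity)
  set κ : ℝ := (q : ℝ) * σ with hκ
  have hκ0 : 0 ≤ κ := by positivity
  have hθκ : c₁ + cb + cM + 1 + Real.log A / Real.log Θ ≤ θ * κ := by rw [hκ]; linarith [hq]
  have hθκκ : θ * κ ≤ κ := by nlinarith
  have hQ1 : c₁ < κ := by linarith
  have hQ2 : cb < θ * κ := by linarith
  have hΘA : ∀ e : ℝ, e ≤ -(Real.log A / Real.log Θ) → Θ ^ e ≤ A⁻¹ := fun e he =>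
    (Real.rpow_le_rpow_of_exponent_le hΘ1.le he).trans_eq (c1_rpow_neg_log_div Θ A hΘ1 hA0)
  have hQ3 : Cb * Θ ^ (cb - θ * κ) ≤ 1 / 2 := by
    have h1 : Θ ^ (cb - θ * κ) ≤ A⁻¹ := hΘA _ (by linarith)
    calc Cb * Θ ^ (cb - θ * κ) ≤ Cb * A⁻¹ := mul_le_mul_of_nonneg_left h1 (by linarith)
      _ ≤ Cb * (2 * Cb)⁻¹ := mul_le_mul_of_nonneg_left (inv_anti₀ (by linarith) hA2) (by linarith)
      _ = 1 / 2 := by field_simp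
  have hQ4 : CM * Cb * Θ ^ (cM + cb - θ * κ) ≤ 1 := by
    have h1 : Θ ^ (cM + cb - θ * κ) ≤ A⁻¹ := hΘA _ (by linarith)
    calc CM * Cb * Θ ^ (cM + cb - θ * κ) ≤ CM * Cb * A⁻¹ := mul_le_mul_of_nonneg_left h1 (by positivity)
      _ ≤ A * A⁻¹ := mul_le_mul_of_nonneg_right hAM (inv_nonneg.2 hA0.le)
      _ = 1 := mul_inv_cancel₀ hA0.ne'
  -- the input at this `q`
  obtain ⟨K₀, sq, hsq0, hsq1, hev⟩ := hIn q
  -- the exponent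
  set t : ℝ := min σ sq with ht
  have ht0 : 0 < t := lt_min hσ0 hsq0
  have htσ : t ≤ σ := min_le_left _ _
  have htsq : t ≤ sq := min_le_right _ _
  have ht1 : t ≤ 1 := by linarith
  have ht1' : t < 1 := by linarith
  have hts : t ≤ s₀ := htσ.trans hσs₀
  have hts' : t ≤ s₀' := htσ.trans hσs₀'
  have hσts : σ ≤ t / sq := by
    rw [le_div_iff₀ hsq0, ht]
    rcases le_total σ sq with h | h
    · rw [min_eq_left h]; nlinarith
    · rw [min_eq_right h]; nlinarith
  -- `K₀ > 0` (the input is non-vacuous at some step)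
  have hK₀ : 0 < K₀ := by
    obtain ⟨k, ℓ₀, hℓ1, -, hℓK, -⟩ := hev.exists
    have h1 : (0 : ℝ) < ℓ₀ * reg.a k := mul_pos (by exact_mod_cast hℓ1) (reg.a_pos k)
    have h2 : (0 : ℝ) < 1 + |Real.log (reg.a k)| := by positivity
    by_contra hK
    push Not at hK
    have : K₀ * (1 + |Real.log (reg.a k)|) ≤ 0 := mul_nonpos_of_nonpos_of_nonneg hK h2.le
    linarith
  -- the rate arithmetic
  obtain ⟨δ, Cr, a₀, hδ, hCr, ha₀, hrate⟩ := c1_closure_rate Θ K₀ C₁ c₁ Cb cb θ κ hΘ1 hK₀ hC₁ hCb hQ1 hQ2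
  -- the input radius as a function of the step
  let P : ℕ → ℕ → Prop := fun k ℓ₀ => 1 ≤ ℓ₀ ∧ ℓ₀ ≤ reg.L k ∧
    (ℓ₀ : ℝ) * reg.a k ≤ K₀ * (1 + |Real.log (reg.a k)|) ∧
    ∀ S : ℕ, reg.L k ≤ S → ∀ (f : Fin Nf) (v : Site 4), v ∈ box 4 S → ‖v‖ = (ℓ₀ : ℝ) →
      (ℓ₀ : ℝ) ^ q * (1 + |reg.β k|) ^ q * cruxMoment Nf (reg.β k) (bareMass reg m k) S f v sq ≤ 1
  let ℓf : ℕ → ℕ := fun k => if h : ∃ ℓ₀, P k ℓ₀ then h.choose else 0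
  have hℓf : ∀ k, (∃ ℓ₀, P k ℓ₀) → P k (ℓf k) := fun k h => by
    simp only [ℓf, dif_pos h]
    exact h.choose_spec
  -- eventual smallness of the spacing
  have hev_a₀ : ∀ᶠ k in atTop, reg.a k ≤ a₀ := reg.tendsto_a.eventually_le_const ha₀
  have hev_hop : ∀ᶠ k in atTop, reg.a k ≤ μ * t / δ := reg.tendsto_a.eventually_le_const (by positivity)
  -- the package
  refine ⟨t, δ, max Cr CH, K₀, fun k _ => ℓf k, ht0, ht1', hδ, hCr.trans (le_max_left _ _), ?_, ?_, ?_⟩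
  · filter_upwards [hev] with k hk f
    exact (hℓf k hk).2.2.1
  · filter_upwards [hev] with k hk f
    exact (hℓf k hk).2.1
  filter_upwards [hev, hev_a₀, hev_hop] with k hk hka hkh S hS f v hv hℓv
  obtain ⟨hℓ1, hℓL, hℓK, hshellIn⟩ := hℓf k hk
  change ((ℓf k : ℕ) : ℝ) ≤ ‖v‖ at hℓv
  set ℓ₀ : ℕ := ℓf k with hℓ₀def
  have hmax0 : 0 ≤ max Cr CH := hCr.trans (le_max_left _ _)
  have hexp : ∀ x : ℝ, 0 ≤ Real.exp x := fun x => (Real.exp_pos x).le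
  by_cases hhop : (41 / 10 : ℝ) ≤ |bareMass reg m k f + 4|
  · -- the hopping window
    have h := hH (reg.β k) (bareMass reg m k) f hhop S t ht0 ht1' v hv
    change cruxMoment Nf (reg.β k) (bareMass reg m k) S f v t ≤ CH * Real.exp (-(μ * t * ‖v‖)) at h
    refine h.trans (mul_le_mul (le_max_right _ _) (Real.exp_le_exp.2 (neg_le_neg ?_)) (hexp _) hmax0)
    have h1 : δ * reg.a k ≤ μ * t := by rwa [le_div_iff₀ hδ, mul_comm] at hkh
    calc δ * (reg.a k * ‖v‖) = (δ * reg.a k) * ‖v‖ := by ring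
      _ ≤ μ * t * ‖v‖ := mul_le_mul_of_nonneg_right h1 (norm_nonneg _)
  · -- outside the hopping window: the bootstrap
    have habs : |bareMass reg m k f + 4| < 41 / 10 := lt_of_not_ge hhop
    obtain ⟨hlo, hhi⟩ := abs_lt.1 habs
    have hm9 : -9 ≤ bareMass reg m k f := by linarith only [hlo]
    have hm1 : bareMass reg m k f ≤ 1 := by linarith only [hhi]
    have hm81 : -(81 / 10 : ℝ) ≤ bareMass reg m k f := by linarith only [hlo]
    have hm01 : bareMass reg m k f ≤ 1 / 10 := by linarith only [hhi]
    have hβ1 : 1 ≤ 1 + |reg.β k| := by have := abs_nonneg (reg.β k); linarith only [this]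
    have hℓ1r : (1 : ℝ) ≤ ℓ₀ := by exact_mod_cast hℓ1
    set Θk : ℝ := (ℓ₀ : ℝ) * (1 + |reg.β k|) with hΘk
    have hℓΘ : (ℓ₀ : ℝ) ≤ Θk := by rw [hΘk]; exact le_mul_of_one_le_right (Nat.cast_nonneg _) hβ1
    -- the corner `ℓ₀ = 1`, `|β_k| ≤ β₀` is empty: `Θ ≤ Θ_k`
    have hΘΘk : Θ ≤ Θk := by
      by_contra hlt
      push Not at hlt
      have hℓ2 : ℓ₀ < 2 := by
        have : (ℓ₀ : ℝ) < 2 := by linarith only [hlt, hΘ2, hℓΘ]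
        exact_mod_cast this
      have hℓeq : ℓ₀ = 1 := by omega
      have hβle : |reg.β k| ≤ β₀ := by
        have : Θk = 1 + |reg.β k| := by rw [hΘk, hℓeq]; push_cast; ring
        linarith only [this, hlt, hΘβ]
      obtain ⟨v₁, hv₁, hv₁n, hv₁m⟩ := hU (reg.β k) hβle (bareMass reg m k) f hm81 hm01 (max (reg.L k) S₀)
        (le_max_right _ _) sq hsq0 hsq1
      have hin := hshellIn (max (reg.L k) S₀) (le_max_left _ _) f v₁ hv₁ (by rw [hv₁n, hℓeq, Nat.cast_one])
      rw [hℓeq, Nat.cast_one, one_pow, one_mul] at hin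
      have h1q : (1 : ℝ) ≤ (1 + |reg.β k|) ^ q := one_le_pow₀ hβ1
      have hcm0 := c1_cruxMoment_nonneg (reg.β k) (bareMass reg m k) (max (reg.L k) S₀) f v₁ sq
      have h2 := mul_le_mul_of_nonneg_right h1q hcm0
      rw [one_mul] at h2
      linarith only [hin, h2, hv₁m]
    have hΘk1 : 1 ≤ Θk := hΘ1.le.trans hΘΘk
    have hΘk0 : 0 < Θk := by linarith only [hΘk1]
    -- the shell input at exponent `t`
    have hshell : ∀ w : Site 4, w ∈ box 4 S → ‖w‖ = (ℓ₀ : ℝ) →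
        pqE Nf S (reg.β k) (bareMass reg m k) (fun U => blockNorm (wilsonD U (bareMass reg m k f))⁻¹ 0
          (Torus.proj (2 * S + 1) w) ^ t) ≤ ((ℓ₀ : ℝ) * (1 + |reg.β k|)) ^ (-κ) := by
      intro w hw hwn
      have h := c1_shell_lower (reg.β k) (bareMass reg m k) S f w q ℓ₀ ht0 htsq hsq1.le hσts hℓ1
        (hshellIn S hS f w hw hwn)
      rwa [c1_cruxMoment_eq_pqE, c1_proj_zero] at h
    obtain ⟨hB1, hB2⟩ := hboot (reg.β k) t (bareMass reg m k) f S ℓ₀ κ ht0 ht1 hts hts' hm9 hm1 hℓ1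
      (hℓL.trans hS) hκ0 hshell
    -- the quantity, the distance
    have hE : cruxMoment Nf (reg.β k) (bareMass reg m k) S f v t =
        pqE Nf S (reg.β k) (bareMass reg m k) (fun U => blockNorm (wilsonD U (bareMass reg m k f))⁻¹ 0
          (Torus.proj (2 * S + 1) v) ^ t) := by
      rw [c1_cruxMoment_eq_pqE, c1_proj_zero]
    have hnorm : ‖v‖ = (Site.supNorm v : ℝ) := c1_norm_eq_supNorm v
    have hn : ℓ₀ ≤ Site.supNorm v := by
      have : (ℓ₀ : ℝ) ≤ Site.supNorm v := by rw [← hnorm]; exact hℓv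
      exact_mod_cast this
    have hvS : Site.supNorm v ≤ S := mem_box_iff_supNorm_le.1 hv
    -- the rate-free bound
    have hrf : cruxMoment Nf (reg.β k) (bareMass reg m k) S f v t ≤ C₁ * Θk ^ (c₁ - κ) := by
      rw [hE]; exact hB1 v hv hn
    -- monotonicity in the size parameter
    have hmono : ∀ e : ℝ, e ≤ 0 → Θk ^ e ≤ Θ ^ e := fun e he => Real.rpow_le_rpow_of_nonpos hΘ0 hΘΘk he
    have hbsmall : Cb * Θk ^ (cb - θ * κ) ≤ 1 / 2 :=
      (mul_le_mul_of_nonneg_left (hmono _ (by linarith only [hQ2])) (by linarith only [hCb])).trans hQ3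
    -- conclusion through the rate arithmetic
    suffices hfin : cruxMoment Nf (reg.β k) (bareMass reg m k) S f v t ≤
        Cr * Real.exp (-(δ * (reg.a k * (Site.supNorm v : ℕ)))) by
      rw [hnorm]
      exact hfin.trans (mul_le_mul_of_nonneg_right (le_max_left _ _) (hexp _))
    by_cases hfar : 4 * (3 * ℓ₀ + 4) ≤ Site.supNorm v
    · -- far: the collar bound is available
      have hfit : 3 * ℓ₀ + 4 ≤ S := by omega
      obtain ⟨b, M, hb0, hb, hM0, hM, hEb⟩ := hB2 hfit (hbsmall.trans (by norm_num)) v hv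
      refine hrate (reg.a k) Θk b M _ ℓ₀ (Site.supNorm v) (reg.a_pos k) hka hℓ1 hΘΘk hℓΘ hℓK hn hrf ?_
      intro _
      refine ⟨hb0, hb.trans hbsmall, hb, hM0, ?_, by rw [hE]; exact hEb⟩
      -- `M b ≤ 1`
      have h1 : M * b ≤ (CM * Θk ^ cM) * (Cb * Θk ^ (cb - θ * κ)) := mul_le_mul hM hb hb0 (by positivity)
      have h2 : (CM * Θk ^ cM) * (Cb * Θk ^ (cb - θ * κ)) = CM * Cb * Θk ^ (cM + cb - θ * κ) := by
        rw [show cM + cb - θ * κ = cM + (cb - θ * κ) by ring, Real.rpow_add hΘk0]; ring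
      have h3 : CM * Cb * Θk ^ (cM + cb - θ * κ) ≤ CM * Cb * Θ ^ (cM + cb - θ * κ) :=
        mul_le_mul_of_nonneg_left (hmono _ (by linarith only [hθκ, hc₁, hLA])) (mul_nonneg hCM (by linarith only [hCb]))
      linarith only [h1, h2, h3, hQ4]
    · -- near: only the rate-free bound is needed
      exact hrate (reg.a k) Θk 0 0 _ ℓ₀ (Site.supNorm v) (reg.a_pos k) hka hℓ1 hΘΘk hℓΘ hℓK hn hrf
        (fun h => absurd h hfar)

end Summit.QuantumFields.QCD.Theorems.VonMisesCirclesC1
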